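/-
Copyright (c) 2026 the pub-hodgecm-mathlib formalisation cell (harness21).  Prover seat hodgecm-mathlib-K2Liu-p02 (g0),
Track B «K2-LIT» ∕ hLiu418 #184♮, unit U1 «POLE INPUT» of the K2_Liu road, file #1: payment of the socket
`K2LiuCurveThetaSigsU1PoleInput.sig_K2LiuHeckeEulerProductRegular` — REGULARITY OF A UNITARY PARTIAL EULER PRODUCT ON `Re s > 1`.
2026-09-03.
-/
import Literature.NumberTheory.GaloisRepresentations.HeckeLFunctionAnalyticProofs
import HarnessLib

/-!
# K2_Liu road (hLiu418 = stmt-HodgeConjecture-24832), unit U1 «POLE INPUT», file #1: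
# a unitary partial Euler product `∏'_{v ∉ S} (1 − ψ(ϖ_v) q_v^{−s})⁻¹` is continuous and zero-free on `Re s > 1`

Cell `pub/hodgecm-mathlib` (D-0151), Track B (21-frontier RULING «PUSH BOTH» 2026-09-03, director req621∕req624,
LEAD F0P6-plan «M-154j» §3), socket module
`Summits/HodgeConjecture/HodgeConjecture/Cruxes/HLiu418/Lines/K2_Liu_CurveThetaSigs_U1_PoleInput.lean`
(planner K2Liu-plan (g0)), socket **`sig_K2LiuHeckeEulerProductRegular`** (#1, size S): for a unitary Hecke
character `ψ` of a number field `K` and a finite set `S` of finite places, the partial Euler product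
`s ↦ ∏'_{v ∉ S} (1 − ψ(ϖ_v) q_v^{−s})⁻¹` is continuous on `{Re s > 1}` and has no zero there (the
denominators `L^S(s+1, ·)`, `L^S(2s+1, ·)` of the constant-term ratio `r(s)` of `E_Q` at `s = 1`,
Liu 2021 Thm. B.4 (1)(a)).

THE MATHEMATICS (Neukirch, *Algebraic Number Theory*, VII (8.1): the Euler product of a Hecke
`L`-series "converges absolutely and uniformly in the domain `Re(s) ≥ 1 + δ`, for all `δ > 0`", and
`L(χ, s) ≠ 0` there).  For unitary `ψ`, `‖ψ(ϖ_v)‖ = 1`, so `‖(1 − ψ(ϖ_v) q_v^{−s})⁻¹ − 1‖ ≤ 2 q_v^{−σ₀}`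
for `Re s ≥ σ₀ ≥ 1` (★ `norm_eulerFactor_sub_one_le`), and `∑_v q_v^{−σ₀} < ∞` for `σ₀ > 1`
(★ `Automorphic.summable_residueCard_rpow_neg`, convergence of `ζ_K(σ₀)`).  The Weierstrass `M`-test
(Mathlib `Summable.hasProdLocallyUniformlyOn_one_add`) gives locally uniform convergence of the product over
ANY set of places — here `{v ∣ v ∉ S}` (the finiteness of `S` is not used) — on `Re s > σ₀`, hence holomorphy
(`TendstoLocallyUniformlyOn.differentiableOn`) and a fortiori continuity on `Re s > 1 = ⋃_{σ₀>1} {Re s > σ₀}`;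
an absolutely convergent product of non-zero factors is non-zero (Mathlib `tprod_one_add_ne_zero_of_summable`).
This is the tree's ★ `HeckeLFunctionAnalyticProofs` (`hasProdLocallyUniformlyOn_heckeLFunction`,
`differentiableOn_heckeLFunction`, `heckeLFunction_ne_zero`), whose index type is `{v ∣ ψ unramified at v}`,
re-run over the index type `{v ∣ v ∉ S}` of the socket.

* §1 `summable_majorant_compl`, `hasProdLocallyUniformlyOn_partialEuler`, `differentiableOn_partialEuler_of_lt`,
  `differentiableOn_partialEuler` (holomorphy on `Re s > 1`), `partialEuler_ne_zero`.
* §2 **`heckeEulerProductRegular`** — `sig_K2LiuHeckeEulerProductRegular` TOKEN FOR TOKEN.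

HONEST LABEL: HC_CM is proved only modulo the 7 printed citations (2 remaining named inputs: hLiu418 =
stmt-HodgeConjecture-24832, h413 = stmt-HodgeConjecture-24833) until rung 0 closes; this file is a
`--supports stmt-HodgeConjecture-24832` helper (floored scaffold of the K2_Liu road) and retires nothing by itself.
-/

noncomputable section

open scoped Topology NNReal
open NumberField IsDedekindDomain Filter Complex Set
open Literature.NumberTheory.GaloisRepresentations
open Literature.NumberTheory.Automorphic

namespace Summit.HodgeConjecture.HodgeConjecture.Cruxes.HLiu418.K2LiuHeckeEulerProductRegular

variable {K : Type} [Field K] [NumberField K]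

/-! ## §1  The Weierstrass `M`-test over the places off `S` -/

/-- The majorant `2 q_v^{−σ₀}` is summable over the places `v ∉ S` for `σ₀ > 1` (convergence of `ζ_K(σ₀)`,
★ `Automorphic.summable_residueCard_rpow_neg`). [cite: NeukirchANT1999, Ch. VII Prop. (8.1)] -/
theorem summable_majorant_compl (S : Set (HeightOneSpectrum (𝓞 K))) {σ₀ : ℝ} (hσ₀ : 1 < σ₀) :
    Summable fun v : {v : HeightOneSpectrum (𝓞 K) // v ∉ S} => 2 * (v.1.residueCard : ℝ) ^ (-σ₀) := by
  refine Summable.mul_left 2 ?_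
  exact (Literature.NumberTheory.Automorphic.summable_residueCard_rpow_neg hσ₀).comp_injective
    Subtype.val_injective

/-- **Locally uniform convergence of the partial Euler product** (Neukirch VII (8.1)): for unitary `ψ`,
any set `S` of finite places and `σ₀ > 1`, `∏_{v ∉ S} (1 − ψ(ϖ_v) q_v^{−s})⁻¹` converges locally uniformly
on `Re s > σ₀` to `s ↦ ∏'_{v ∉ S} (1 − ψ(ϖ_v) q_v^{−s})⁻¹` (Weierstrass `M`-test: ★ `norm_eulerFactor_sub_one_le`,
`summable_majorant_compl`; Mathlib `Summable.hasProdLocallyUniformlyOn_one_add`).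
[cite: NeukirchANT1999, Ch. VII Prop. (8.1)] -/
theorem hasProdLocallyUniformlyOn_partialEuler {ψ : HeckeCharacter K} (hψ : ψ.IsUnitary)
    (S : Set (HeightOneSpectrum (𝓞 K))) {σ₀ : ℝ} (hσ₀ : 1 < σ₀) :
    HasProdLocallyUniformlyOn
      (fun (v : {v : HeightOneSpectrum (𝓞 K) // v ∉ S}) (s : ℂ) =>
        (1 - ψ.valueAtUniformizer v.1 * ((v.1.residueCard : ℂ) ^ (-s)))⁻¹)
      (fun s : ℂ => ∏' v : {v : HeightOneSpectrum (𝓞 K) // v ∉ S},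
        (1 - ψ.valueAtUniformizer v.1 * ((v.1.residueCard : ℂ) ^ (-s)))⁻¹)
      {s : ℂ | σ₀ < s.re} := by
  have hopen : IsOpen {s : ℂ | σ₀ < s.re} := isOpen_lt continuous_const Complex.continuous_re
  have h := Summable.hasProdLocallyUniformlyOn_one_add (K := {s : ℂ | σ₀ < s.re})
    (f := fun (v : {v : HeightOneSpectrum (𝓞 K) // v ∉ S}) (s : ℂ) =>
      (1 - ψ.valueAtUniformizer v.1 * ((v.1.residueCard : ℂ) ^ (-s)))⁻¹ - 1)
    hopen (summable_majorant_compl S hσ₀)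
    (Filter.Eventually.of_forall fun v s hs =>
      norm_eulerFactor_sub_one_le hψ v.1 hσ₀.le (le_of_lt hs))
    (fun v s hs => ((differentiableAt_eulerFactor hψ v.1
      (lt_trans (by linarith) (show σ₀ < s.re from hs))).sub_const 1).continuousAt.continuousWithinAt)
  simpa only [add_sub_cancel] using h

/-- The partial Euler product is holomorphic on `Re s > σ₀` for every `σ₀ > 1` (locally uniform limit of the
holomorphic finite partial products, Mathlib `TendstoLocallyUniformlyOn.differentiableOn`).
[cite: NeukirchANT1999, Ch. VII Prop. (8.1)] -/
theorem differentiableOn_partialEuler_of_lt {ψ : HeckeCharacter K} (hψ : ψ.IsUnitary)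
    (S : Set (HeightOneSpectrum (𝓞 K))) {σ₀ : ℝ} (hσ₀ : 1 < σ₀) :
    DifferentiableOn ℂ (fun s : ℂ => ∏' v : {v : HeightOneSpectrum (𝓞 K) // v ∉ S},
        (1 - ψ.valueAtUniformizer v.1 * ((v.1.residueCard : ℂ) ^ (-s)))⁻¹) {s : ℂ | σ₀ < s.re} := by
  refine (hasProdLocallyUniformlyOn_iff_tendstoLocallyUniformlyOn.mp
    (hasProdLocallyUniformlyOn_partialEuler hψ S hσ₀)).differentiableOn
    (Filter.Eventually.of_forall fun T => ?_) (isOpen_lt continuous_const Complex.continuous_re)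
  refine DifferentiableOn.fun_finsetProd fun v _ => fun s hs => ?_
  exact (differentiableAt_eulerFactor hψ v.1
    (lt_trans (by linarith) (show σ₀ < s.re from hs))).differentiableWithinAt

/-- **Holomorphy of the partial Euler product on `Re s > 1`** for a unitary Hecke character `ψ` and any set
`S` of finite places (`{Re s > 1} = ⋃_{σ₀ > 1} {Re s > σ₀}`). [cite: NeukirchANT1999, Ch. VII Prop. (8.1)] -/
theorem differentiableOn_partialEuler {ψ : HeckeCharacter K} (hψ : ψ.IsUnitary)
    (S : Set (HeightOneSpectrum (𝓞 K))) :
    DifferentiableOn ℂ (fun s : ℂ => ∏' v : {v : HeightOneSpectrum (𝓞 K) // v ∉ S},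
        (1 - ψ.valueAtUniformizer v.1 * ((v.1.residueCard : ℂ) ^ (-s)))⁻¹) {s : ℂ | 1 < s.re} := by
  intro s hs
  have hs' : 1 < s.re := hs
  have hσ : 1 < (1 + s.re) / 2 := by linarith
  have hmem : s ∈ {z : ℂ | (1 + s.re) / 2 < z.re} := by
    show (1 + s.re) / 2 < s.re
    linarith
  exact ((differentiableOn_partialEuler_of_lt hψ S hσ).differentiableAt
    ((isOpen_lt continuous_const Complex.continuous_re).mem_nhds hmem)).differentiableWithinAt

/-- **Non-vanishing of the partial Euler product on `Re s > 1`**: an absolutely convergent product of non-zero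
factors is non-zero (★ `one_sub_valueAtUniformizer_mul_cpow_ne_zero`, Mathlib `tprod_one_add_ne_zero_of_summable`).
[cite: NeukirchANT1999, Ch. VII Prop. (8.1)] -/
theorem partialEuler_ne_zero {ψ : HeckeCharacter K} (hψ : ψ.IsUnitary)
    (S : Set (HeightOneSpectrum (𝓞 K))) {s : ℂ} (hs : 1 < s.re) :
    (∏' v : {v : HeightOneSpectrum (𝓞 K) // v ∉ S},
      (1 - ψ.valueAtUniformizer v.1 * ((v.1.residueCard : ℂ) ^ (-s)))⁻¹) ≠ 0 := by
  have hsum : Summable fun v : {v : HeightOneSpectrum (𝓞 K) // v ∉ S} =>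
      ‖(1 - ψ.valueAtUniformizer v.1 * ((v.1.residueCard : ℂ) ^ (-s)))⁻¹ - 1‖ :=
    Summable.of_nonneg_of_le (fun _ => norm_nonneg _)
      (fun v => norm_eulerFactor_sub_one_le hψ v.1 hs.le le_rfl)
      (summable_majorant_compl S hs)
  have hne : ∀ v : {v : HeightOneSpectrum (𝓞 K) // v ∉ S},
      1 + ((1 - ψ.valueAtUniformizer v.1 * ((v.1.residueCard : ℂ) ^ (-s)))⁻¹ - 1) ≠ 0 := by
    intro v
    rw [add_sub_cancel]
    exact inv_ne_zero (one_sub_valueAtUniformizer_mul_cpow_ne_zero hψ v.1 (by linarith))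
  have := tprod_one_add_ne_zero_of_summable hne hsum
  simp only [add_sub_cancel] at this
  exact this

/-! ## §2  The head -/

/-- **PAYMENT OF `sig_K2LiuHeckeEulerProductRegular`** (socket #1 of unit U1 «POLE INPUT» of the K2_Liu road,
`Cruxes/HLiu418/Lines/K2_Liu_CurveThetaSigs_U1_PoleInput.lean`, TOKEN FOR TOKEN): for a unitary Hecke character
`ψ` of a number field `K` and a finite set `S` of finite places, the partial Euler product
`s ↦ ∏'_{v ∉ S} (1 − ψ(ϖ_v) q_v^{−s})⁻¹` is continuous on `{Re s > 1}` and has no zero there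
(§1: holomorphy ⇒ continuity; non-vanishing).  In Liu 2021 this is the regularity of the denominators
`L^S(s+1, ·)`, `L^S(2s+1, ·)` of the constant-term ratio `r(s)` at `s = 1` behind Thm. B.4 (1)(a).
[cite: Liu2021, Thm. B.4 (1)(a), p. 98] [cite: NeukirchANT1999, Ch. VII Prop. (8.1)] -/
theorem heckeEulerProductRegular :
    ∀ (K : Type) [Field K] [NumberField K] (ψ : HeckeCharacter K), ψ.IsUnitary →
      ∀ (S : Set (HeightOneSpectrum (𝓞 K))), S.Finite →
        ContinuousOn (fun s : ℂ => ∏' v : {v : HeightOneSpectrum (𝓞 K) // v ∉ S},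
            (1 - ψ.valueAtUniformizer v.1 * ((v.1.residueCard : ℂ) ^ (-s)))⁻¹) {s : ℂ | 1 < s.re} ∧
          ∀ s : ℂ, 1 < s.re →
            (∏' v : {v : HeightOneSpectrum (𝓞 K) // v ∉ S},
              (1 - ψ.valueAtUniformizer v.1 * ((v.1.residueCard : ℂ) ^ (-s)))⁻¹) ≠ 0 := by
  intro K _ _ ψ hψ S _
  exact ⟨(differentiableOn_partialEuler hψ S).continuousOn, fun s hs => partialEuler_ne_zero hψ S hs⟩

end Summit.HodgeConjecture.HodgeConjecture.Cruxes.HLiu418.K2LiuHeckeEulerProductRegular
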